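import Summits.CriticalPhenomena.PercolationContinuityZ3.Theorems.Transplant.FKConnectivityAllQPat3KNetCaseAC
import Summits.CriticalPhenomena.PercolationContinuityZ3.Theorems.Transplant.FKConnectivityAllQPat3KNetCaseCD
import Summits.CriticalPhenomena.PercolationContinuityZ3.Theorems.Transplant.FKConnectivityAllQPat3KNetCaseC
import Summits.CriticalPhenomena.PercolationContinuityZ3.Theorems.Transplant.FKConnectivityAllQPat3MinorGraphCone
import HarnessLib

/-!
# Connectivity correlation inequalities for `φ_{w,q}`, every `q > 0` — **THEOREM 𝒯₂(𝒦): the eleven-member family `famP11` is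
# nonnegative on EVERY MINOR of EVERY bridge–series–parallel network at (pole, pole, inner vertex)** (census g39 §1 / census g41)

Proof file (`--supports stmt-CriticalPhenomena-4575`), census lineage (gen 41) of LANE 2's FK sub-programme; builds on p205010 (kernel
theorem, internal audit signed; external expert review pending).  No definitions, no named facts, no sorries; standard axioms.

**`FK.famP11C_nonneg_of_isKNet`** — for every 𝒦-network `N` between `x` and `y` (`FK.IsKNet`: the least class closed under edge /
SERIES / PARALLEL / BRIDGE = the two-terminal networks all of whose 3-connected torsos are `K₄`'s, i.e. the W₄-minor-free class of
census g39), every free set `E ⊆ N`, every contracted set `C ⊆ N`, every inner vertex `s` of `N` and every nonnegative weight: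
every member of `FK.famP11 = [T_sym, STAR_x, STAR_x~, STAR_s, C1⁺, C2, C2~, S¹C1, S¹C1~, S¹C3, S¹C3~]` is nonnegative on the minor
`(E, C)` read at `(x, y, s)` (`FK.mval2C`); levelwise form `FK.famP11C_level_nonneg_of_isKNet`; in particular `T_sym ≥ 0` and
`STAR ≥ 0` at (pole, pole, inner) on every minor of every 𝒦-network (`FK.tsymC_level_nonneg_of_isKNet`,
`FK.starXC_level_nonneg_of_isKNet`), the placement is SP-good (`FK.spGoodC_inner_of_isKNet`) and Conjecture T's functional is
nonnegative there for every `q > 0` (`FK.antipodalT_nonneg_of_isKNet_inner`).  This extends census g37's THEOREMS 𝒯₁/𝒯₂ on minors (`FK.famT12C_nonneg`, two-terminal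
series–parallel) one rung up the wheel ladder, with the family corrected as census g39 §2 requires (`C1 → C1⁺`, `C3` dropped).
PROOF: strong induction on `|N|`; edge / series / parallel exactly as `FK.famC_nonneg_of_isTTSP` with `famP11`'s four `decide`d
closure certificates (`…Pat3FamP11`); BRIDGE: the mark sits in a slot at a pole (`FK.bridge_case_ac`, the other pole slots by the
symmetries `FK.BridgeSep.symm / swap_cd` and `FK.famP11_mval2C_nonneg_swap`), in the slot `cd` (`FK.bridge_case_cd`) or at an inner
skeleton vertex (`FK.bridge_case_c`) — each reduced by census g40's one-sided two-sum law to the Wheatstone bridge with plain slots in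
all `{deleted, free, contracted}` states, the deleted ones smaller 𝒦-networks and the others census g41's kernel-certified K-state
leaves (`…Pat3BridgeLeafK`: 32 + 2·16 states × 11 members, kit j242290 + `decide`).
[cite: AyyerLinussonRavichandran2025, §7 (p. 22)] [cite: Grimmett2006, §3.9 (pp. 63–64)]
-/

namespace Summit.CriticalPhenomena.PercolationContinuityZ3.Theorems

namespace FK

open SimpleGraph Literature.Probability.LatticeModels Literature.Probability.Percolation
open scoped Classical

variable {V : Type*} [Fintype V]

/-! ### The pole swap on `famP11` -/

omit [Fintype V] in
/-- **`famP11` is closed under the pole swap `x ↔ y`** (weight form): nonnegativity of all eleven members at `(x, y, s)` on a minor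
gives it at `(y, x, s)` (`FK.lev2C_swap_xy`; `T_sym, STAR_s, C1⁺` are self-mirror, the other members come in mirror pairs). [folklore] -/
theorem famP11_mval2C_nonneg_swap {E C : Finset (Sym2 V)} {x y s : V}
    (h : ∀ w : ℕ → ℝ, (∀ k, 0 ≤ w k) → ∀ i : ℕ, 0 ≤ mval2C w E C x y s (famGet famP11 i))
    (w : ℕ → ℝ) (hw : ∀ k, 0 ≤ w k) (i : ℕ) : 0 ≤ mval2C w E C y x s (famGet famP11 i) := by
  have hl : ∀ j μ, 0 ≤ lev2C E C x y s (famGet famP11 j) μ := fun j μ => lev2C_nonneg_of_mval2C (fun w' hw' => h w' hw' j) μ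
  refine mval2C_nonneg_of_lev2C (fun μ => ?_) hw
  rw [lev2C_swap_xy]
  by_cases hi : i < 11
  · interval_cases i
    · show 0 ≤ lev2C E C x y s (mirror2 tsym2Tab) μ
      rw [mirror2_tsym2Tab]; exact hl 0 μ
    · show 0 ≤ lev2C E C x y s (mirror2 starXTab) μ
      exact hl 2 μ
    · show 0 ≤ lev2C E C x y s (mirror2 (mirror2 starXTab)) μ
      rw [mirror2_mirror2]; exact hl 1 μ
    · show 0 ≤ lev2C E C x y s (mirror2 starSTab) μ
      rw [mirror2_starSTab]; exact hl 3 μ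
    · show 0 ≤ lev2C E C x y s (mirror2 c1plusTab) μ
      rw [lev2C_congr01 (fun P Q => mirror2_c1plusTab 0 (by norm_num) P Q) (fun P Q => mirror2_c1plusTab 1 (by norm_num) P Q)]
      exact hl 4 μ
    · show 0 ≤ lev2C E C x y s (mirror2 c2Tab) μ
      exact hl 6 μ
    · show 0 ≤ lev2C E C x y s (mirror2 (mirror2 c2Tab)) μ
      rw [mirror2_mirror2]; exact hl 5 μ
    · show 0 ≤ lev2C E C x y s (mirror2 s1c1Tab) μ
      exact hl 8 μ
    · show 0 ≤ lev2C E C x y s (mirror2 (mirror2 s1c1Tab)) μ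
      rw [mirror2_mirror2]; exact hl 7 μ
    · show 0 ≤ lev2C E C x y s (mirror2 s1c3Tab) μ
      exact hl 10 μ
    · show 0 ≤ lev2C E C x y s (mirror2 (mirror2 s1c3Tab)) μ
      rw [mirror2_mirror2]; exact hl 9 μ
  · rw [famGet_of_le (show famP11.length ≤ i from le_of_not_gt hi)]
    exact lev2C_nonneg_of_coef _ _ _ _ _ (fun _ _ _ => le_rfl) μ

/-! ### The induction -/

/-- **THEOREM 𝒯₂(𝒦), induction form** (strong induction on the number of edges). [cite: AyyerLinussonRavichandran2025, §7 (p. 22)] -/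
theorem famP11C_nonneg_of_isKNet_aux (n : ℕ) : ∀ {N : Finset (Sym2 V)} {x y : V}, N.card ≤ n → IsKNet N x y →
    ∀ E C : Finset (Sym2 V), E ⊆ N → C ⊆ N → ∀ s : V, (∃ e ∈ N, s ∈ e) → s ≠ x → s ≠ y →
      ∀ w : ℕ → ℝ, (∀ k, 0 ≤ w k) → ∀ i : ℕ, 0 ≤ mval2C w E C x y s (famGet famP11 i) := by
  induction n with
  | zero =>
    intro N x y hc hN
    have := hN.card_pos
    omega
  | succ n ih =>
    intro N x y hcard hN E C hE hC s hs hsa hsb w hw i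
    have ih' : ∀ ⦃N : Finset (Sym2 V)⦄ ⦃x y : V⦄, N.card ≤ n → IsKNet N x y → ∀ E C : Finset (Sym2 V), E ⊆ N → C ⊆ N →
        ∀ s : V, (∃ e ∈ N, s ∈ e) → s ≠ x → s ≠ y → ∀ w : ℕ → ℝ, (∀ k, 0 ≤ w k) → ∀ i : ℕ,
          0 ≤ mval2C w E C x y s (famGet famP11 i) := fun N x y hc hN => ih hc hN
    by_cases hi : famP11.length ≤ i
    · rw [famGet_of_le hi, mval2C_zero]
    have hi' : i < famP11.length := lt_of_not_ge hi
    cases hN with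
    | edge hab =>
      obtain ⟨e, he, hse⟩ := hs
      rw [Finset.mem_singleton] at he
      subst he
      rcases Sym2.mem_iff.1 hse with h | h
      · exact absurd h hsa
      · exact absurd h hsb
    | @series N₁ N₂ _ m₀ _ h₁ h₂ hd hV ha hb =>
      have hc12 : (N₁ ∪ N₂).card = N₁.card + N₂.card := Finset.card_union_of_disjoint hd
      have hc₁ : N₁.card ≤ n := by have := h₂.card_pos; omega
      have hc₂ : N₂.card ≤ n := by have := h₁.card_pos; omega
      have g₁ : ∀ e ∈ (↑N₁ : Set (Sym2 V)), ∀ z ∈ e, z ∈ {z : V | ∃ e ∈ N₁, z ∈ e} := fun e he z hz => ⟨e, he, hz⟩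
      have g₂ : ∀ e ∈ (↑N₂ : Set (Sym2 V)), ∀ z ∈ e, z ∈ {z : V | ∃ e ∈ N₂, z ∈ e} := fun e he z hz => ⟨e, he, hz⟩
      have gS : {z : V | ∃ e ∈ N₁, z ∈ e} ∩ {z : V | ∃ e ∈ N₂, z ∈ e} ⊆ ({m₀} : Set V) :=
        fun z hz => hV z hz.1 hz.2
      have gaV₂ : x ∉ {z : V | ∃ e ∈ N₂, z ∈ e} := fun ⟨e, he, hae⟩ => ha e he hae
      have gbV₁ : y ∉ {z : V | ∃ e ∈ N₁, z ∈ e} := fun ⟨e, he, hbe⟩ => hb e he hbe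
      have gam : x ≠ m₀ := by
        obtain ⟨e, he, hme⟩ := h₂.left_mem
        intro ham; exact ha e he (ham ▸ hme)
      have gbm : y ≠ m₀ := by
        obtain ⟨e, he, hme⟩ := h₁.right_mem
        intro hbm; exact hb e he (hbm ▸ hme)
      have gab : x ≠ y := by
        obtain ⟨e, he, hae⟩ := h₁.left_mem
        intro hab; exact hb e he (hab ▸ hae)
      rw [subset_union_split hE, subset_union_split hC]
      have sE₁ : E ∩ N₁ ⊆ N₁ := Finset.inter_subset_right
      have sE₂ : E ∩ N₂ ⊆ N₂ := Finset.inter_subset_right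
      have sC₁ : C ∩ N₁ ⊆ N₁ := Finset.inter_subset_right
      have sC₂ : C ∩ N₂ ⊆ N₂ := Finset.inter_subset_right
      by_cases hsm : s = m₀
      · subst hsm
        exact mval2C_serS_nonneg hd g₁ g₂ sE₁ sC₁ sE₂ sC₂ gS gaV₂ gbV₁ gam gbm gab (certSerSFam_spec famP11_cert_serS hi') w hw
      · obtain ⟨e, he, hse⟩ := hs
        rcases Finset.mem_union.1 he with he₁ | he₂
        · have hsV₂ : s ∉ {z : V | ∃ e ∈ N₂, z ∈ e} := fun hs₂ => hsm (hV s ⟨e, he₁, hse⟩ hs₂)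
          exact mval2C_serR_nonneg hd g₁ g₂ sE₁ sC₁ sE₂ sC₂ gS gaV₂ hsV₂ gbV₁ gam gbm gab hsm hsb
            (G := fun a' a'' => famGet famP11 (selP11SerR i a' a'').1) (m := fun a' a'' => (selP11SerR i a' a'').2.1)
            (k := fun a' a'' => (selP11SerR i a' a'').2.2) (fun a' a'' => (certGlueFam_spec famP11_cert_serR hi' a' a'').1)
            (fun a' a'' => (certGlueFam_spec famP11_cert_serR hi' a' a'').2)
            (fun a' a'' w' hw' => ih' hc₁ h₁ _ _ sE₁ sC₁ s ⟨e, he₁, hse⟩ hsa hsm w' hw' _) w hw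
        · have hsV₁ : s ∉ {z : V | ∃ e ∈ N₁, z ∈ e} := fun hs₁ => hsm (hV s hs₁ ⟨e, he₂, hse⟩)
          have has : x ≠ s := fun h => gaV₂ (h ▸ ⟨e, he₂, hse⟩)
          exact mval2C_serL_nonneg hd g₁ g₂ sE₁ sC₁ sE₂ sC₂ gS gaV₂ gbV₁ hsV₁ gam gbm gab hsm has
            (G := fun a' a'' => famGet famP11 (selP11SerL i a' a'').1) (m := fun a' a'' => (selP11SerL i a' a'').2.1)
            (k := fun a' a'' => (selP11SerL i a' a'').2.2) (fun a' a'' => (certGlueFam_spec famP11_cert_serL hi' a' a'').1)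
            (fun a' a'' => (certGlueFam_spec famP11_cert_serL hi' a' a'').2)
            (fun a' a'' w' hw' => ih' hc₂ h₂ _ _ sE₂ sC₂ s ⟨e, he₂, hse⟩ hsm hsb w' hw' _) w hw
    | @parallel N₁ N₂ _ _ h₁ h₂ hd hV =>
      have hc12 : (N₁ ∪ N₂).card = N₁.card + N₂.card := Finset.card_union_of_disjoint hd
      have hc₁ : N₁.card ≤ n := by have := h₂.card_pos; omega
      have hc₂ : N₂.card ≤ n := by have := h₁.card_pos; omega
      have g₁ : ∀ e ∈ (↑N₁ : Set (Sym2 V)), ∀ z ∈ e, z ∈ {z : V | ∃ e ∈ N₁, z ∈ e} := fun e he z hz => ⟨e, he, hz⟩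
      have g₂ : ∀ e ∈ (↑N₂ : Set (Sym2 V)), ∀ z ∈ e, z ∈ {z : V | ∃ e ∈ N₂, z ∈ e} := fun e he z hz => ⟨e, he, hz⟩
      have gS : {z : V | ∃ e ∈ N₁, z ∈ e} ∩ {z : V | ∃ e ∈ N₂, z ∈ e} ⊆ ({x, y} : Set V) := by
        intro z hz
        rcases hV z hz.1 hz.2 with h | h
        · exact Or.inl h
        · exact Or.inr h
      have gS' : {z : V | ∃ e ∈ N₂, z ∈ e} ∩ {z : V | ∃ e ∈ N₁, z ∈ e} ⊆ ({x, y} : Set V) :=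
        fun z hz => gS ⟨hz.2, hz.1⟩
      have gab : x ≠ y := h₁.ne
      rw [subset_union_split hE, subset_union_split hC]
      have sE₁ : E ∩ N₁ ⊆ N₁ := Finset.inter_subset_right
      have sE₂ : E ∩ N₂ ⊆ N₂ := Finset.inter_subset_right
      have sC₁ : C ∩ N₁ ⊆ N₁ := Finset.inter_subset_right
      have sC₂ : C ∩ N₂ ⊆ N₂ := Finset.inter_subset_right
      obtain ⟨e, he, hse⟩ := hs
      rcases Finset.mem_union.1 he with he₁ | he₂
      · have hsV₂ : s ∉ {z : V | ∃ e ∈ N₂, z ∈ e} := by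
          intro hs₂
          rcases hV s ⟨e, he₁, hse⟩ hs₂ with h | h
          · exact hsa h
          · exact hsb h
        rw [Finset.union_comm (E ∩ N₁), Finset.union_comm (C ∩ N₁)]
        exact mval2C_par_nonneg hd.symm g₂ g₁ sE₂ sC₂ sE₁ sC₁ gS' gab hsV₂ hsa hsb
          (G := fun a' a'' => famGet famP11 (selP11Par i a' a'').1) (m := fun a' a'' => (selP11Par i a' a'').2.1)
          (k := fun a' a'' => (selP11Par i a' a'').2.2) (fun a' a'' => (certGlueFam_spec famP11_cert_par hi' a' a'').1)
          (fun a' a'' => (certGlueFam_spec famP11_cert_par hi' a' a'').2)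
          (fun a' a'' w' hw' => ih' hc₁ h₁ _ _ sE₁ sC₁ s ⟨e, he₁, hse⟩ hsa hsb w' hw' _) w hw
      · have hsV₁ : s ∉ {z : V | ∃ e ∈ N₁, z ∈ e} := by
          intro hs₁
          rcases hV s hs₁ ⟨e, he₂, hse⟩ with h | h
          · exact hsa h
          · exact hsb h
        exact mval2C_par_nonneg hd g₁ g₂ sE₁ sC₁ sE₂ sC₂ gS gab hsV₁ hsa hsb
          (G := fun a' a'' => famGet famP11 (selP11Par i a' a'').1) (m := fun a' a'' => (selP11Par i a' a'').2.1)
          (k := fun a' a'' => (selP11Par i a' a'').2.2) (fun a' a'' => (certGlueFam_spec famP11_cert_par hi' a' a'').1)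
          (fun a' a'' => (certGlueFam_spec famP11_cert_par hi' a' a'').2)
          (fun a' a'' w' hw' => ih' hc₂ h₂ _ _ sE₂ sC₂ s ⟨e, he₂, hse⟩ hsa hsb w' hw' _) w hw
    | @bridge Qac Qad Qbc Qbd Qcd _ _ c d hac had hbc hbd hcd hsep =>
      -- locate the inner mark: in the span of one of the five slots, possibly at `c` or `d`
      obtain ⟨e, he, hse⟩ := hs
      simp only [Finset.mem_union] at he
      rcases he with (((he | he) | he) | he) | he
      · -- slot `ac`
        by_cases hsc : s = c
        · subst hsc; exact bridge_case_c ih' hac had hbc hbd hcd hsep hcard hE hC w hw i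
        · exact bridge_case_ac ih' hac had hbc hbd hcd hsep hcard ⟨e, he, hse⟩ hsa hsc hE hC w hw i
      · -- slot `ad`: swap `c ↔ d`
        have eN : Qac ∪ Qad ∪ Qbc ∪ Qbd ∪ Qcd = Qad ∪ Qac ∪ Qbd ∪ Qbc ∪ Qcd := by ac_rfl
        rw [eN] at hcard hE hC
        by_cases hsd : s = d
        · subst hsd; exact bridge_case_c ih' had hac hbd hbc hcd.symm hsep.swap_cd hcard hE hC w hw i
        · exact bridge_case_ac ih' had hac hbd hbc hcd.symm hsep.swap_cd hcard ⟨e, he, hse⟩ hsa hsd hE hC w hw i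
      · -- slot `bc`: swap the poles
        by_cases hsc : s = c
        · subst hsc; exact bridge_case_c ih' hac had hbc hbd hcd hsep hcard hE hC w hw i
        · have eN : Qac ∪ Qad ∪ Qbc ∪ Qbd ∪ Qcd = Qbc ∪ Qbd ∪ Qac ∪ Qad ∪ Qcd := by ac_rfl
          rw [eN] at hcard hE hC
          exact famP11_mval2C_nonneg_swap
            (fun w' hw' i' => bridge_case_ac ih' hbc hbd hac had hcd hsep.symm hcard ⟨e, he, hse⟩ hsb hsc hE hC w' hw' i') w hw i
      · -- slot `bd`: swap the poles and `c ↔ d`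
        by_cases hsd : s = d
        · have eN : Qac ∪ Qad ∪ Qbc ∪ Qbd ∪ Qcd = Qad ∪ Qac ∪ Qbd ∪ Qbc ∪ Qcd := by ac_rfl
          rw [eN] at hcard hE hC
          subst hsd; exact bridge_case_c ih' had hac hbd hbc hcd.symm hsep.swap_cd hcard hE hC w hw i
        · have eN : Qac ∪ Qad ∪ Qbc ∪ Qbd ∪ Qcd = Qbd ∪ Qbc ∪ Qad ∪ Qac ∪ Qcd := by ac_rfl
          rw [eN] at hcard hE hC
          exact famP11_mval2C_nonneg_swap
            (fun w' hw' i' => bridge_case_ac ih' hbd hbc had hac hcd.symm hsep.symm.swap_cd hcard ⟨e, he, hse⟩ hsb hsd hE hC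
              w' hw' i') w hw i
      · -- slot `cd`
        by_cases hsc : s = c
        · subst hsc; exact bridge_case_c ih' hac had hbc hbd hcd hsep hcard hE hC w hw i
        · by_cases hsd : s = d
          · have eN : Qac ∪ Qad ∪ Qbc ∪ Qbd ∪ Qcd = Qad ∪ Qac ∪ Qbd ∪ Qbc ∪ Qcd := by ac_rfl
            rw [eN] at hcard hE hC
            subst hsd; exact bridge_case_c ih' had hac hbd hbc hcd.symm hsep.swap_cd hcard hE hC w hw i
          · exact bridge_case_cd ih' hac had hbc hbd hcd hsep hcard ⟨e, he, hse⟩ hsc hsd hE hC w hw i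

/-- **THEOREM 𝒯₂(𝒦) (weight form): every member of `famP11` is nonnegative, for every nonnegative weight, on every minor `(E, C)`
(`E, C ⊆ N`) of every bridge–series–parallel network `N` between `x` and `y`, read at `(x, y, s)` with `s` an inner vertex of `N`.**
[cite: AyyerLinussonRavichandran2025, §7 (p. 22)] -/
theorem famP11C_nonneg_of_isKNet {N E C : Finset (Sym2 V)} {x y s : V} (hN : IsKNet N x y) (hE : E ⊆ N) (hC : C ⊆ N)
    (hs : ∃ e ∈ N, s ∈ e) (hsx : s ≠ x) (hsy : s ≠ y) {w : ℕ → ℝ} (hw : ∀ k, 0 ≤ w k) (i : ℕ) :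
    0 ≤ mval2C w E C x y s (famGet famP11 i) :=
  famP11C_nonneg_of_isKNet_aux N.card le_rfl hN E C hE hC s hs hsx hsy w hw i

/-- **THEOREM 𝒯₂(𝒦), levelwise form.** [cite: AyyerLinussonRavichandran2025, §7 (p. 22)] -/
theorem famP11C_level_nonneg_of_isKNet {N E C : Finset (Sym2 V)} {x y s : V} (hN : IsKNet N x y) (hE : E ⊆ N) (hC : C ⊆ N)
    (hs : ∃ e ∈ N, s ∈ e) (hsx : s ≠ x) (hsy : s ≠ y) (i μ : ℕ) : 0 ≤ lev2C E C x y s (famGet famP11 i) μ :=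
  lev2C_nonneg_of_mval2C (fun _ hw => famP11C_nonneg_of_isKNet hN hE hC hs hsx hsy hw i) μ

/-- **`T_sym ≥ 0` levelwise at (pole, pole, inner) on every minor of every 𝒦-network.** [cite: AyyerLinussonRavichandran2025, §7 (p. 22)] -/
theorem tsymC_level_nonneg_of_isKNet {N E C : Finset (Sym2 V)} {x y s : V} (hN : IsKNet N x y) (hE : E ⊆ N) (hC : C ⊆ N)
    (hs : ∃ e ∈ N, s ∈ e) (hsx : s ≠ x) (hsy : s ≠ y) (μ : ℕ) : 0 ≤ lev2C E C x y s tsym2Tab μ :=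
  famP11C_level_nonneg_of_isKNet hN hE hC hs hsx hsy 0 μ

/-- **`STAR_x ≥ 0` levelwise at (pole, pole, inner), apex the pole `x`, on every minor of every 𝒦-network.**
[cite: AyyerLinussonRavichandran2025, §7 (p. 22)] -/
theorem starXC_level_nonneg_of_isKNet {N E C : Finset (Sym2 V)} {x y s : V} (hN : IsKNet N x y) (hE : E ⊆ N) (hC : C ⊆ N)
    (hs : ∃ e ∈ N, s ∈ e) (hsx : s ≠ x) (hsy : s ≠ y) (μ : ℕ) : 0 ≤ lev2C E C x y s starXTab μ :=
  famP11C_level_nonneg_of_isKNet hN hE hC hs hsx hsy 1 μ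

/-- **`STAR_s ≥ 0` levelwise at (pole, pole, inner), apex the inner mark, on every minor of every 𝒦-network.**
[cite: AyyerLinussonRavichandran2025, §7 (p. 22)] -/
theorem starSC_level_nonneg_of_isKNet {N E C : Finset (Sym2 V)} {x y s : V} (hN : IsKNet N x y) (hE : E ⊆ N) (hC : C ⊆ N)
    (hs : ∃ e ∈ N, s ∈ e) (hsx : s ≠ x) (hsy : s ≠ y) (μ : ℕ) : 0 ≤ lev2C E C x y s starSTab μ :=
  famP11C_level_nonneg_of_isKNet hN hE hC hs hsx hsy 3 μ

/-! ### Corollaries: SP-goodness and Conjecture T at (pole, pole, inner) on every minor of every 𝒦-network -/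

/-- **The placement (pole, pole, inner vertex) is SP-good on every minor of every bridge–series–parallel network**: `T_sym ≥ 0` and the
three `STAR ≥ 0` levelwise (`FK.SPGoodC`), the four members `T_sym, STAR_x, STAR_x~, STAR_s` of `famP11` — census g37's
`FK.spGoodC_inner` one rung up the wheel ladder. [cite: AyyerLinussonRavichandran2025, §7 (p. 22)] -/
theorem spGoodC_inner_of_isKNet {N E C : Finset (Sym2 V)} {x y s : V} (hN : IsKNet N x y) (hE : E ⊆ N) (hC : C ⊆ N)
    (hs : ∃ e ∈ N, s ∈ e) (hsx : s ≠ x) (hsy : s ≠ y) : SPGoodC E C x y s :=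
  SPGoodC.of_mval2 (fun _ hw => famP11C_nonneg_of_isKNet hN hE hC hs hsx hsy hw 0)
    (fun _ hw => famP11C_nonneg_of_isKNet hN hE hC hs hsx hsy hw 1) (fun _ hw => famP11C_nonneg_of_isKNet hN hE hC hs hsx hsy hw 2)
    (fun _ hw => famP11C_nonneg_of_isKNet hN hE hC hs hsx hsy hw 3)

/-- **CONJECTURE T AT (pole, pole, inner) ON EVERY MINOR OF EVERY BRIDGE–SERIES–PARALLEL NETWORK, every `q > 0`**:
`0 ≤ antipodalT q x y s F C` for `F, C ⊆ N`, `N` a 𝒦-network between `x, y`, `s` an inner vertex (census gen 25's functional;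
`FK.antipodalT_nonneg_of_spGoodC`).  The all-placements statement waits for THEOREM SP(W₄-free). [cite: AyyerLinussonRavichandran2025, §7 eq. (13)–(15) (p. 22)] -/
theorem antipodalT_nonneg_of_isKNet_inner {q : ℝ} (hq : 0 < q) {N F C : Finset (Sym2 V)} {x y s : V} (hN : IsKNet N x y)
    (hF : F ⊆ N) (hC : C ⊆ N) (hs : ∃ e ∈ N, s ∈ e) (hsx : s ≠ x) (hsy : s ≠ y) :
    0 ≤ antipodalT q x y s (↑F : BondConfig V) (↑C : BondConfig V) :=
  antipodalT_nonneg_of_spGoodC hq (spGoodC_inner_of_isKNet hN hF hC hs hsx hsy)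

end FK

end Summit.CriticalPhenomena.PercolationContinuityZ3.Theorems
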